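import Summits.Ventures.CertifiedQuantumChemistry.Certificates.HubbardRingL6LiftQMapRows0
import Summits.Ventures.CertifiedQuantumChemistry.Certificates.HubbardRingL6LiftQMapRows1
import Summits.Ventures.CertifiedQuantumChemistry.Certificates.HubbardRingL6LiftQMapRows2
import Summits.Ventures.CertifiedQuantumChemistry.Certificates.HubbardRingL6LiftGMapRows0
import Summits.Ventures.CertifiedQuantumChemistry.Certificates.HubbardRingL6LiftGMapRows1
import Summits.Ventures.CertifiedQuantumChemistry.Certificates.HubbardRingL6LiftGMapRows2
import Summits.Ventures.CertifiedQuantumChemistry.Certificates.HubbardRingL4LiftFeasible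
import HarnessLib

/-!
# Ventures/CertifiedQuantumChemistry — Certificates/HubbardRingL6LiftFeasible.lean: LAYER 2 of the L = 6 lift assembly —
# the exact lift FAMILY `(γ(ε), Γ(ε))` of the half-filled Hubbard 6-ring is `(3,3)`-sector-DQG-feasible for every
# `0 < ε ≤ 2⁻⁵¹` — i.e. at every `U = 1/ε ≥ 2⁵¹`

HONEST FRAMING (verbatim): certified bounds for a stated model Hamiltonian in a stated basis; not a
claim about the real molecule beyond that model. Auxiliary objects only; no model energy is bounded in THIS file
(the energy and the plateau floor are `…L6LiftPlateauFloor.lean`).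

Seat rdm-B (gen 43; plan `tools/x14-g42/l6/MEMO-L6-KERNEL-FLOOR.md` §8; the `L = 6` twin of gen 42's `…L4LiftFeasible.lean`).
THE OBJECT: the one-parameter family `(γ(ε), Γ(ε)) = Σ_{j ≤ 2} ε^j (γ_j, Γ_j)` (FIELD `ℚ`: no `√2`, no second parameter) of
the EXACT lift `pub-qchem-rdmb/ab-files/v44/lift2_L6_DQG.json` (rdm-B gen 24, format `rdmB-exact-lift/2`; until now words +
exact-certificate grade), read in the LEAN CONVENTION: `Γ_j = LiftL6.l6GG j` on the 144 ordered-pair codes (signed scatter-sums of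
the landed pair-block tables, `…L6LiftPairPSD.lean`), `γ_j = LiftL6.l6Gam j` (`…L6LiftCoeffRows.lean`); NO SDP solver anywhere.

WHAT IS PROVED (by LINEARITY from kernel facts already in the tree; this file runs no large `decide`):
* §1 `liftGamC6 ε`, `liftGGC6 ε` — the family as complex matrices on `Orb (Fin 6)` / ordered pairs, with real entries
  `liftGamR6`, `liftGGR6` (read through the codes `eOrb6`, `ePair6`);
* §2 the three POSITIVITY conditions over `ℂ` for `0 < ε ≤ 2⁻⁵¹`: `Γ(ε) ⪰ 0`, `Q ⪰ 0`, `G ⪰ 0` — LAYER 1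
  (`l6realGG_posSemidef`, `l6realQQ_posSemidef`, `l6realGm_posSemidef`: all nine symmetry blocks certified along the family by
  `Rows/PencilBlockCertificateRat.lean`) carried to `qMap`/`gMap` OF THE FAMILY through the kernel identities
  `Q_j = qMapP6 (γ_j, Γ_j)`, `G_j = gMapP6 (γ_j, Γ_j)` (`…L6Lift{Q,G}MapRows{0,1,2}.lean`) and affinity/linearity of the maps (the
  `Q`-map's constant rides on the coefficient `j = 0` of weight `ε⁰ = 1`; Kronecker symbols become the real atoms `LiftL4.kd`, so
  each bridge is ONE polynomial identity closed by `ring`), then complexified (`DQGGap.posSemidef_map_ofReal`) and re-indexed;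
* §3 every LINEAR row of `IsDQGFeasibleSector 3 3` (Hermiticity, `S_z` selection, traces `3, 3`, contraction onto `5γ`,
  antisymmetries, block traces `6, 6, 9`) from the coefficientwise kernel rows of `…L6LiftCoeffRows.lean` by exchanging finite
  sums; hence **`lift6_isDQGFeasibleSector`**.
NOT a row of `CERTIFIED.md`, no claim node; S-U UNTOUCHED. 0 sorry; four small `def`s (`liftGamR6`, `liftGGR6`, `liftGamC6`,
`liftGGC6`), standard axioms. References (docstring-only): D. A. Mazziotti, Adv. Chem. Phys. 134 (2007) ch. 3 §II.B
eqs. (11)–(17), §II.F; M. Nakata et al., J. Chem. Phys. 128 (2008) 164113 §II.C.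
-/

set_option linter.style.longLine false

namespace Summit.Ventures.CertifiedQuantumChemistry

namespace LiftL6

open Matrix Finset DQGGap LiftL4
open Literature.MathematicalPhysics.QuantumLattice Literature.MathematicalPhysics.QuantumChemistry
open scoped ComplexOrder

/-! ## §1 The family as real and complex matrices -/

/-- The real one-matrix family of the lift: `γ(ε)_{xy} = Σ_j ε^j · γ_j(x, y)` (`ε = 1/U`), read through the orbital codes. -/
noncomputable def liftGamR6 (ε : ℝ) (x y : Orb (Fin 6)) : ℝ :=
  ∑ j : Fin 3, ε ^ (j : ℕ) * ((l6Gam j (eOrb6 x) (eOrb6 y) : ℚ) : ℝ)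

/-- The real two-matrix family of the lift on ordered pairs: `Γ(ε)_{PR} = Σ_j ε^j · Γ_j(P, R)`, read through the pair codes. -/
noncomputable def liftGGR6 (ε : ℝ) (P R : Orb (Fin 6) × Orb (Fin 6)) : ℝ :=
  ∑ j : Fin 3, ε ^ (j : ℕ) * ((l6GG j (ePair6 P) (ePair6 R) : ℚ) : ℝ)

/-- The lift family's one-matrix as a complex matrix (real entries). -/
noncomputable def liftGamC6 (ε : ℝ) : Matrix (Orb (Fin 6)) (Orb (Fin 6)) ℂ :=
  fun x y => ((liftGamR6 ε x y : ℝ) : ℂ)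

/-- The lift family's two-matrix as a complex matrix (real entries). -/
noncomputable def liftGGC6 (ε : ℝ) : Matrix (Orb (Fin 6) × Orb (Fin 6)) (Orb (Fin 6) × Orb (Fin 6)) ℂ :=
  fun P R => ((liftGGR6 ε P R : ℝ) : ℂ)

/-- Sums over the orbitals of the 6-ring are sums over sites and spins. -/
theorem sum_orb6 {M : Type*} [AddCommMonoid M] (f : Orb (Fin 6) → M) :
    ∑ i : Orb (Fin 6), f i = ∑ x : Fin 6, ∑ σ : Fin 2, f (orb x σ) := by
  rw [← Equiv.sum_comp (toLex (α := Fin 6 × Fin 2)) f, Fintype.sum_prod_type]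

/-! ## §2 The three positivity conditions along the family (from layer 1) -/

/-- `Γ(ε)` on pairs is the landed `l6realGG` re-indexed. -/
theorem l6realGG_ePair (ε : ℝ) (P R : Orb (Fin 6) × Orb (Fin 6)) : l6realGG ε (ePair6 P) (ePair6 R) = liftGGR6 ε P R := by
  simp only [l6realGG, liftGGR6, Matrix.sum_apply, Matrix.smul_apply, Matrix.map_apply, smul_eq_mul]

/-- The complex two-matrix of the family is the complexification of `l6realGG`, re-indexed to ordered pairs. -/
theorem liftGGC6_eq (ε : ℝ) : liftGGC6 ε = ((l6realGG ε).map Complex.ofRealHom).submatrix ePair6 ePair6 := by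
  ext P R
  simp only [liftGGC6, Matrix.submatrix_apply, Matrix.map_apply, Complex.ofRealHom_eq_coe, l6realGG_ePair]

/-- The cast of the code-level `Q`-map. -/
theorem cast_qMapP6 (c : Bool) (γ : Orb (Fin 6) → Orb (Fin 6) → ℚ)
    (Γ : Orb (Fin 6) × Orb (Fin 6) → Orb (Fin 6) × Orb (Fin 6) → ℚ) (p q : Orb (Fin 6) × Orb (Fin 6)) :
    ((qMapP6 c γ Γ p q : ℚ) : ℝ) =
      (if c then ((if p.1 = q.1 ∧ p.2 = q.2 then (1 : ℝ) else 0) - (if p.1 = q.2 ∧ p.2 = q.1 then (1 : ℝ) else 0)) else 0) -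
        (if p.2 = q.2 then ((γ q.1 p.1 : ℚ) : ℝ) else 0) + (if p.2 = q.1 then ((γ q.2 p.1 : ℚ) : ℝ) else 0) +
        (if p.1 = q.2 then ((γ q.1 p.2 : ℚ) : ℝ) else 0) - (if p.1 = q.1 then ((γ q.2 p.2 : ℚ) : ℝ) else 0) +
        ((Γ q p : ℚ) : ℝ) := by
  unfold qMapP6
  simp only [Rat.cast_add, Rat.cast_sub, apply_ite (Rat.cast : ℚ → ℝ), Rat.cast_one, Rat.cast_zero]

/-- The cast of the code-level `G`-map. -/
theorem cast_gMapP6 (γ : Orb (Fin 6) → Orb (Fin 6) → ℚ) (Γ : Orb (Fin 6) × Orb (Fin 6) → Orb (Fin 6) × Orb (Fin 6) → ℚ)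
    (p q : Orb (Fin 6) × Orb (Fin 6)) :
    ((gMapP6 γ Γ p q : ℚ) : ℝ) = (if p.2 = q.2 then ((γ p.1 q.1 : ℚ) : ℝ) else 0) - ((Γ (p.1, q.2) (q.1, p.2) : ℚ) : ℝ) := by
  unfold gMapP6
  simp only [Rat.cast_sub, apply_ite (Rat.cast : ℚ → ℝ), Rat.cast_zero]

/-- **`Q(ε)` is the real `Q`-map of the family** (the kernel identities `Q_j = qMapP6 (γ_j, Γ_j)` and linearity in the
weights `ε^j`; the affine constant rides on the coefficient `j = 0` of weight `1`). -/
theorem l6realQQ_ePair (ε : ℝ) (P R : Orb (Fin 6) × Orb (Fin 6)) :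
    l6realQQ ε (ePair6 P) (ePair6 R) = qMapR (liftGamR6 ε) (liftGGR6 ε) P R := by
  -- stage 1: expand the coefficient sum and insert the kernel identities `Q_j = qMapP6 (γ_j, Γ_j)`
  simp only [l6realQQ, Matrix.sum_apply, Matrix.smul_apply, Matrix.map_apply, smul_eq_mul, Fin.sum_univ_three, Fin.isValue,
    l6QQ_eq_qMapP0, l6QQ_eq_qMapP1, l6QQ_eq_qMapP2]
  -- stage 2: evaluate both sides as polynomials in the Kronecker symbols and the table entries
  simp only [toFin6, Equiv.symm_apply_apply, cast_qMapP6, gamO, GamO, liftGamR6, liftGGR6, qMapR, Fin.sum_univ_three,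
    Fin.isValue, Fin.val_zero, Fin.val_one, Fin.val_two, pow_zero, pow_one, one_mul, if_true, Bool.false_eq_true,
    if_false, zero_sub]
  -- stage 3: Kronecker symbols as real atoms; one polynomial identity
  simp only [ite_and, ite_eq_kd_mul]
  ring

/-- **`G(ε)` is the real `G`-map of the family** (kernel identities `G_j = gMapP6 (γ_j, Γ_j)`, linearity). -/
theorem l6realGm_ePair (ε : ℝ) (P R : Orb (Fin 6) × Orb (Fin 6)) :
    l6realGm ε (ePair6 P) (ePair6 R) = gMapR (liftGamR6 ε) (liftGGR6 ε) P R := by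
  simp only [l6realGm, Matrix.sum_apply, Matrix.smul_apply, Matrix.map_apply, smul_eq_mul, Fin.sum_univ_three, Fin.isValue,
    l6Gm_eq_gMapP0, l6Gm_eq_gMapP1, l6Gm_eq_gMapP2]
  simp only [toFin6, Equiv.symm_apply_apply, cast_gMapP6, gamO, GamO, liftGamR6, liftGGR6, gMapR, Fin.sum_univ_three,
    Fin.isValue, Fin.val_zero, Fin.val_one, Fin.val_two, pow_zero, pow_one, one_mul]
  simp only [ite_eq_kd_mul]
  ring

/-- The `Q`-matrix of the complex family is the complexification of `l6realQQ`, re-indexed. -/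
theorem qMap_liftC6_eq (ε : ℝ) :
    qMap (liftGamC6 ε) (liftGGC6 ε) = ((l6realQQ ε).map Complex.ofRealHom).submatrix ePair6 ePair6 := by
  change qMap (fun i j => ((liftGamR6 ε i j : ℝ) : ℂ)) (fun P R => ((liftGGR6 ε P R : ℝ) : ℂ)) = _
  rw [qMap_ofReal]
  ext P R
  simp only [Matrix.submatrix_apply, Matrix.map_apply, Complex.ofRealHom_eq_coe, l6realQQ_ePair]

/-- The `G`-matrix of the complex family is the complexification of `l6realGm`, re-indexed. -/
theorem gMap_liftC6_eq (ε : ℝ) :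
    gMap (liftGamC6 ε) (liftGGC6 ε) = ((l6realGm ε).map Complex.ofRealHom).submatrix ePair6 ePair6 := by
  change gMap (fun i j => ((liftGamR6 ε i j : ℝ) : ℂ)) (fun P R => ((liftGGR6 ε P R : ℝ) : ℂ)) = _
  rw [gMap_ofReal]
  ext P R
  simp only [Matrix.submatrix_apply, Matrix.map_apply, Complex.ofRealHom_eq_coe, l6realGm_ePair]

/-- **D-condition of the family**: `Γ(ε) ⪰ 0` over `ℂ` for `0 < ε ≤ 2⁻⁵¹`. -/
theorem liftGGC6_posSemidef {ε : ℝ} (hε0 : 0 < ε) (hε1 : ε ≤ 1 / 2 ^ 51) : (liftGGC6 ε).PosSemidef := by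
  rw [liftGGC6_eq]
  exact (posSemidef_map_ofReal (l6realGG_posSemidef hε0 hε1)).submatrix ePair6

/-- **Q-condition of the family**: `Q(γ(ε), Γ(ε)) ⪰ 0` over `ℂ` for `0 < ε ≤ 2⁻⁵¹`. -/
theorem qMap_liftC6_posSemidef {ε : ℝ} (hε0 : 0 < ε) (hε1 : ε ≤ 1 / 2 ^ 51) :
    (qMap (liftGamC6 ε) (liftGGC6 ε)).PosSemidef := by
  rw [qMap_liftC6_eq]
  exact (posSemidef_map_ofReal (l6realQQ_posSemidef hε0 hε1)).submatrix ePair6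

/-- **G-condition of the family**: `G(γ(ε), Γ(ε)) ⪰ 0` over `ℂ` for `0 < ε ≤ 2⁻⁵¹`. -/
theorem gMap_liftC6_posSemidef {ε : ℝ} (hε0 : 0 < ε) (hε1 : ε ≤ 1 / 2 ^ 51) :
    (gMap (liftGamC6 ε) (liftGGC6 ε)).PosSemidef := by
  rw [gMap_liftC6_eq]
  exact (posSemidef_map_ofReal (l6realGm_posSemidef hε0 hε1)).submatrix ePair6

/-! ## §3 The linear rows along the family (from the coefficientwise kernel facts, by linearity) -/

/-- Entries of the real one-matrix family at orbitals. -/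
theorem liftGamR6_orb (ε : ℝ) (p : Fin 6) (σ : Fin 2) (q : Fin 6) (τ : Fin 2) :
    liftGamR6 ε (orb p σ) (orb q τ) = ∑ j : Fin 3, ε ^ (j : ℕ) * ((l6Gam j (eOrb6 (orb p σ)) (eOrb6 (orb q τ)) : ℚ) : ℝ) :=
  rfl

/-- Entries of the real two-matrix family at orbital pairs. -/
theorem liftGGR6_orb (ε : ℝ) (a b c d : Orb (Fin 6)) :
    liftGGR6 ε (a, b) (c, d) = ∑ j : Fin 3, ε ^ (j : ℕ) * ((l6GG j (ePair6 (a, b)) (ePair6 (c, d)) : ℚ) : ℝ) :=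
  rfl

/-- Linearity: a finite sum of family values is the family value of the summed coefficients. -/
theorem sum_family6 {α : Type*} (s : Finset α) (ε : ℝ) (f : Fin 3 → α → ℚ) :
    ∑ a ∈ s, ∑ j : Fin 3, ε ^ (j : ℕ) * ((f j a : ℚ) : ℝ) = ∑ j : Fin 3, ε ^ (j : ℕ) * ((∑ a ∈ s, f j a : ℚ) : ℝ) := by
  rw [Finset.sum_comm]
  refine Finset.sum_congr rfl fun j _ => ?_
  rw [Rat.cast_sum, Finset.mul_sum]

/-- Only the coefficient `j = 0` (weight `ε⁰ = 1`) carries affine data: `Σ_j ε^j [j = 0]·v = v`. -/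
theorem sum_weight_flag0 (ε : ℝ) (v : ℚ) :
    ∑ j : Fin 3, ε ^ (j : ℕ) * ((if (j : ℕ) = 0 then v else 0 : ℚ) : ℝ) = v := by
  simp [Fin.sum_univ_three]

/-- The real one-matrix family is symmetric. -/
theorem liftGamR6_symm (ε : ℝ) (p : Fin 6) (σ : Fin 2) (q : Fin 6) (τ : Fin 2) :
    liftGamR6 ε (orb q τ) (orb p σ) = liftGamR6 ε (orb p σ) (orb q τ) := by
  rw [liftGamR6_orb, liftGamR6_orb]
  refine Finset.sum_congr rfl fun j _ => ?_
  rw [(l6Gam_rows j).1 p q σ τ]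

/-- `S_z` selection rule of the one-matrix family. -/
theorem liftGamR6_spin (ε : ℝ) (p q : Fin 6) {σ τ : Fin 2} (h : σ ≠ τ) : liftGamR6 ε (orb p σ) (orb q τ) = 0 := by
  rw [liftGamR6_orb]
  refine Finset.sum_eq_zero fun j _ => ?_
  rw [(l6Gam_rows j).2.1 p q σ τ h, Rat.cast_zero, mul_zero]

/-- Spin-up trace of the one-matrix family: `3`. -/
theorem liftGamR6_trace_up (ε : ℝ) : ∑ x : Fin 6, liftGamR6 ε (orb x 0) (orb x 0) = 3 := by
  simp only [liftGamR6_orb]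
  rw [sum_family6]
  simp only [fun j => (l6Gam_rows j).2.2.1, sum_weight_flag0, Rat.cast_ofNat]

/-- Spin-down trace of the one-matrix family: `3`. -/
theorem liftGamR6_trace_down (ε : ℝ) : ∑ x : Fin 6, liftGamR6 ε (orb x 1) (orb x 1) = 3 := by
  simp only [liftGamR6_orb]
  rw [sum_family6]
  simp only [fun j => (l6Gam_rows j).2.2.2, sum_weight_flag0, Rat.cast_ofNat]

/-- Contraction row of the two-matrix family: `Σ_{rμ} Γ(pσ rμ; qτ rμ) = 5·γ(pσ; qτ)`. -/
theorem liftGGR6_contract (ε : ℝ) (p : Fin 6) (σ : Fin 2) (q : Fin 6) (τ : Fin 2) :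
    ∑ r : Fin 6, ∑ μ : Fin 2, liftGGR6 ε (orb p σ, orb r μ) (orb q τ, orb r μ) = 5 * liftGamR6 ε (orb p σ) (orb q τ) := by
  simp only [liftGGR6_orb, liftGamR6_orb]
  simp only [sum_family6]
  rw [Finset.mul_sum]
  refine Finset.sum_congr rfl fun j _ => ?_
  rw [l6GG_contract j p σ q τ]
  push_cast
  ring

/-- `αα` block trace of the two-matrix family: `6 = 3·(3−1)`. -/
theorem liftGGR6_trace_upUp (ε : ℝ) :
    ∑ x : Fin 6, ∑ y : Fin 6, liftGGR6 ε (orb x 0, orb y 0) (orb x 0, orb y 0) = 6 := by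
  simp only [liftGGR6_orb]
  simp only [sum_family6]
  simp only [fun j => (l6GG_blockTraces j).1, sum_weight_flag0, Rat.cast_ofNat]

/-- `ββ` block trace of the two-matrix family: `6`. -/
theorem liftGGR6_trace_downDown (ε : ℝ) :
    ∑ x : Fin 6, ∑ y : Fin 6, liftGGR6 ε (orb x 1, orb y 1) (orb x 1, orb y 1) = 6 := by
  simp only [liftGGR6_orb]
  simp only [sum_family6]
  simp only [fun j => (l6GG_blockTraces j).2.1, sum_weight_flag0, Rat.cast_ofNat]

/-- `αβ` block trace of the two-matrix family: `9 = 3·3`. -/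
theorem liftGGR6_trace_upDown (ε : ℝ) :
    ∑ x : Fin 6, ∑ y : Fin 6, liftGGR6 ε (orb x 0, orb y 1) (orb x 0, orb y 1) = 9 := by
  simp only [liftGGR6_orb]
  simp only [sum_family6]
  simp only [fun j => (l6GG_blockTraces j).2.2, sum_weight_flag0, Rat.cast_ofNat]

/-- The complex one-matrix family is Hermitian (real symmetric), for every `ε`. -/
theorem liftGamC6_isHermitian (ε : ℝ) : (liftGamC6 ε).IsHermitian := by
  have hs := (toLex (α := Fin 6 × Fin 2)).surjective
  refine Matrix.IsHermitian.ext fun i j => ?_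
  obtain ⟨⟨p, σ⟩, rfl⟩ := hs i
  obtain ⟨⟨q, τ⟩, rfl⟩ := hs j
  show star (((liftGamR6 ε (orb q τ) (orb p σ) : ℝ) : ℂ)) = ((liftGamR6 ε (orb p σ) (orb q τ) : ℝ) : ℂ)
  rw [Complex.star_def, Complex.conj_ofReal, liftGamR6_symm]

/-- The real two-matrix family is antisymmetric in the first pair. -/
theorem liftGGR6_swap_fst (ε : ℝ) (a b : Orb (Fin 6)) (R : Orb (Fin 6) × Orb (Fin 6)) :
    liftGGR6 ε (b, a) R = -liftGGR6 ε (a, b) R := by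
  simp only [liftGGR6, ← Finset.sum_neg_distrib]
  refine Finset.sum_congr rfl fun j _ => ?_
  rw [l6GG_orb_swap_fst, Rat.cast_neg, mul_neg]

/-- The real two-matrix family is antisymmetric in the second pair. -/
theorem liftGGR6_swap_snd (ε : ℝ) (P : Orb (Fin 6) × Orb (Fin 6)) (a b : Orb (Fin 6)) :
    liftGGR6 ε P (b, a) = -liftGGR6 ε P (a, b) := by
  simp only [liftGGR6, ← Finset.sum_neg_distrib]
  refine Finset.sum_congr rfl fun j _ => ?_
  rw [l6GG_orb_swap_snd, Rat.cast_neg, mul_neg]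

/-- The complex two-matrix family is antisymmetric in the first pair, for every `ε`. -/
theorem liftGGC6_swap_fst (ε : ℝ) (i j : Orb (Fin 6)) (R : Orb (Fin 6) × Orb (Fin 6)) :
    liftGGC6 ε (j, i) R = -liftGGC6 ε (i, j) R := by
  show ((liftGGR6 ε (j, i) R : ℝ) : ℂ) = -((liftGGR6 ε (i, j) R : ℝ) : ℂ)
  rw [liftGGR6_swap_fst, Complex.ofReal_neg]

/-- The complex two-matrix family is antisymmetric in the second pair, for every `ε`. -/
theorem liftGGC6_swap_snd (ε : ℝ) (P : Orb (Fin 6) × Orb (Fin 6)) (k l : Orb (Fin 6)) :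
    liftGGC6 ε P (l, k) = -liftGGC6 ε P (k, l) := by
  show ((liftGGR6 ε P (l, k) : ℝ) : ℂ) = -((liftGGR6 ε P (k, l) : ℝ) : ℂ)
  rw [liftGGR6_swap_snd, Complex.ofReal_neg]

/-- **THE ROWS.** For every `ε` the complex family satisfies every LINEAR row of `IsDQGFeasibleSector 3 3`; given the three
positivity conditions it is feasible. -/
theorem isDQGFeasibleSector_of_psd3 (ε : ℝ) (hD : (liftGGC6 ε).PosSemidef)
    (hQ : (qMap (liftGamC6 ε) (liftGGC6 ε)).PosSemidef) (hG : (gMap (liftGamC6 ε) (liftGGC6 ε)).PosSemidef) :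
    IsDQGFeasibleSector 3 3 (liftGamC6 ε) (liftGGC6 ε) := by
  have hs := (toLex (α := Fin 6 × Fin 2)).surjective
  have hγ : ∀ x y, liftGamC6 ε x y = ((liftGamR6 ε x y : ℝ) : ℂ) := fun _ _ => rfl
  have hΓ : ∀ P R, liftGGC6 ε P R = ((liftGGR6 ε P R : ℝ) : ℂ) := fun _ _ => rfl
  refine ⟨⟨liftGamC6_isHermitian ε, hD, hQ, hG, ?_, ?_, liftGGC6_swap_fst ε, liftGGC6_swap_snd ε⟩,
    ?_, ?_, ?_, ?_, ?_, ?_⟩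
  · -- trace_one
    rw [sum_orb6]
    simp only [Fin.sum_univ_two, hγ, Finset.sum_add_distrib]
    rw [← Complex.ofReal_sum, ← Complex.ofReal_sum, liftGamR6_trace_up, liftGamR6_trace_down]
    norm_num
  · -- contraction
    intro i k
    obtain ⟨⟨p, σ⟩, rfl⟩ := hs i
    obtain ⟨⟨q, τ⟩, rfl⟩ := hs k
    show ∑ j, liftGGC6 ε (orb p σ, j) (orb q τ, j) = (((3 + 3 : ℕ) : ℂ) - 1) * liftGamC6 ε (orb p σ) (orb q τ)
    rw [sum_orb6]
    simp only [hΓ, hγ]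
    simp_rw [← Complex.ofReal_sum]
    rw [liftGGR6_contract]
    push_cast
    ring
  · intro p q σ τ hστ
    rw [hγ, liftGamR6_spin ε p q hστ, Complex.ofReal_zero]
  · simp only [hγ]
    rw [← Complex.ofReal_sum, liftGamR6_trace_up]
    norm_num
  · simp only [hγ]
    rw [← Complex.ofReal_sum, liftGamR6_trace_down]
    norm_num
  · simp only [hΓ]
    simp_rw [← Complex.ofReal_sum]
    rw [liftGGR6_trace_upUp]
    norm_num
  · simp only [hΓ]
    simp_rw [← Complex.ofReal_sum]
    rw [liftGGR6_trace_downDown]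
    norm_num
  · simp only [hΓ]
    simp_rw [← Complex.ofReal_sum]
    rw [liftGGR6_trace_upDown]
    norm_num

/-- **THE L = 6 LIFT FAMILY IS `(3,3)`-SECTOR-DQG-FEASIBLE** for every `0 < ε ≤ 2⁻⁵¹` (`ε = 1/U`, i.e. for every
`U ≥ 2⁵¹`): layer 1's block certificates give `D, Q, G ⪰ 0`, §3 the linear rows. -/
theorem lift6_isDQGFeasibleSector {ε : ℝ} (hε0 : 0 < ε) (hε1 : ε ≤ 1 / 2 ^ 51) :
    IsDQGFeasibleSector 3 3 (liftGamC6 ε) (liftGGC6 ε) :=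
  isDQGFeasibleSector_of_psd3 ε (liftGGC6_posSemidef hε0 hε1) (qMap_liftC6_posSemidef hε0 hε1)
    (gMap_liftC6_posSemidef hε0 hε1)

end LiftL6

end Summit.Ventures.CertifiedQuantumChemistry
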